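import Mathlib
import HarnessLib
import HarnessLib.Audit
import Summits.AtomisticToContinuum.Statement
import Literature.MathematicalPhysics.QuantumManyBody.PeriodicBoseGas
import Literature.MathematicalPhysics.QuantumManyBody.SwapPurity
import Literature.MathematicalPhysics.QuantumManyBody.GroundState
import Literature.MathematicalPhysics.QuantumManyBody.BoseGasStructureFactor
import HarnessLib.Audit.Status.Attr

/-!
Route: BECInsertionVariance

DORMANT since 2026-08-23T03:18:44Z (reconciler: no traction for 5.9 d (last activity item-evidence-added at 2026-08-17T05:59:59Z); parked, not closed — `ledger route dormant route-AtomisticToContinuum-BECInsertionVariance --off` to reac) — unstaffed, not closed; items shared with open routes are served there. `ledger route dormant <id> --off` reactivates.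

# Route BECInsertionVariance — BEC from a bounded teleportation entropy (insertion log-amplitude
variance) of the positive ground state

It suffices to show X = InsertionEntropyBound ∧ GroundStateCondensate (card
swap-affinity-insertion-variance; conforming gen-2 re-open of the
retired route BECSwapAffinity, now typed over THE nonnegative Dirichlet ground state Ψ₀ =
`BoseGas.groundState v N L`, L = (N/ρ)^(1/3), and
decided by `closes`). Put p(X,Y) = Ψ₀(X)²Ψ₀(Y)² on two independent copies and let q = p after
exchanging the first coordinate x₀ ↔ y₀.
Exact identity (in tree, `swapPurity_eq_lintegral_of_nonneg`): tr(γ²)/N² = swapPurity = ∫√(pq), the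
Bhattacharyya affinity of p and q;
Penrose–Onsager (5) (in tree, `succ_mul_swapPurity_le_maxOccupation`): λ_max(γ) ≥ N·swapPurity;
truncated Jensen on G = {q ≠ 0}:
∫√(pq) ≥ P(G)·exp(−D/(2P(G))), D = ∫_G p (log p − log q)⁺ = the accessible TELEPORTATION ENTROPY
(mean excess insertion log-amplitude of a
boson moved to an independent position). InsertionEntropyBound: for every repulsive finite-range v
and all small ρ there is C with P(G) ≥ 1/2
and D ≤ C for all large N. GroundStateCondensate: λ_max(γ_Ψ₀) ≤ condensateNumber
(uniqueness/compactness). Then condensate fraction ≥ ½e^(−C).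
The cruxes below X are the card's R/H/L decomposition of "D = O(1)": linear response of log Ψ₀ to
long-wavelength density waves against a
HYPERUNIFORM structure factor (IR, the k^(d−2) test) and a one-body log-Harnack property at the
healing scale (UV).
Lean: `∀ v : ℝ → ENNReal,
Literature.MathematicalPhysics.QuantumManyBody.BoseGas.IsRepulsiveFiniteRange v → ∃ ρ₀ : ℝ, 0 < ρ₀ ∧
∀ ρ : ℝ, 0 < ρ → ρ < ρ₀ → ∃ C : ℝ, ∀ᶠ n : ℕ in Filter.atTop, let Ψ₀ :
Literature.MathematicalPhysics.QuantumManyBody.BoseGas.Config (n + 1) → ℝ :=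
Literature.MathematicalPhysics.QuantumManyBody.BoseGas.groundState v (n + 1)
(Literature.MathematicalPhysics.QuantumManyBody.BoseGas.sideLength ρ (n + 1)); let p :
Literature.MathematicalPhysics.QuantumManyBody.BoseGas.Config (n + 1) ×
Literature.MathematicalPhysics.QuantumManyBody.BoseGas.Config (n + 1) → ℝ := fun Z => Ψ₀ Z.1 ^ 2 *
Ψ₀ Z.2 ^ 2; let q : Literature.MathematicalPhysics.QuantumManyBody.BoseGas.Config (n + 1) ×
Literature.MathematicalPhysics.QuantumManyBody.BoseGas.Config (n + 1) → ℝ := fun Z => Ψ₀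
(Function.update Z.1 0 (Z.2 0)) ^ 2 * Ψ₀ (Function.update Z.2 0 (Z.1 0)) ^ 2; (1 / 2 : ENNReal) ≤
(∫⁻ Z in {Z | q Z ≠ 0}, ENNReal.ofReal (p Z)) ∧ (∫⁻ Z in {Z | q Z ≠ 0}, ENNReal.ofReal (p Z *
(Real.log (p Z) - Real.log (q Z)))) ≤ ENNReal.ofReal C`

## Assembly
Pure logic, kernel-checked in the planner's Sketch.lean (rc 0; axioms propext, Classical.choice,
Quot.sound) and supplied as glue.lean:
`theorem closes (hH : GroundStateHyperuniform) (hL : OneBodyLogHarnack) (hR : EntropyFromStructure)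
(hAcc : GroundStateAccessible)
(hJ : TruncatedSwapJensen) (hCnd : GroundStateCondensate) (hF : EntropyFrame) :
BoseEinsteinCondensation := hF ⟨target⟩ hJ hCnd`, where
⟨target⟩ : InsertionEntropyBound is obtained from hH, hL, hR, hAcc by taking ρ₀ = the min of the
four ρ₀'s, C_H and C_L from H and L at ρ,
C from R at (C_H, C_L), and intersecting the four eventual sets in n (the bodies are verbatim
identical, so R's hypotheses are H's and L's
conclusions). The target item itself, proved directly, closes the route through the same frame
(tenure edit of `closes` to `hF hA hJ hCnd`).

Rationale: WHY THIS LINE. Positivity of the Dirichlet ground state is structural information no energy-window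
method uses; the swap-affinity identity (HerdmanEtAl2014 /
HastingsEtAl2010 estimator; PenroseOnsager1956 §4 (5)–(7)) plus Jensen turns thermodynamic-limit BEC
into a statement about ONE scalar field,
the insertion log-amplitude x ↦ −log Ψ₀(x,X̂)²: condensate fraction ≥ ½exp(−mean work to teleport
one atom), mode-free (tr γ², so Dirichlet wall
layers and generalized condensation are harmless). For pair-product states this is Reatto1969 /
Chester1970 / GirvinMacdonald1987; the route
transfers it to the TRUE ground state by a multiscale decomposition: scales ≤ r = (ρa)^(−1/2) by
one-variable log-Harnack (crux L), scales ≫ r by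
linear response of log Ψ₀ to density waves with a C/|k| symbol (ReattoChester1967) against S_N(k) =
O(|k|/√(ρa)) (crux H, PitaevskiiStringari1991
Schwarz inequality + a static-response energy bound in the FournaisSolovej2020 technology): Var ≈
ρ∫|ĥ|²S d³k has integrand ∝ k^(d−2),
convergent in d = 3, log-divergent in d = 1 where it reproduces Lenard1964's n₀ ≍ √N
(ForresterEtAl2003). Imported areas: information
inequalities (Bhattacharyya/KL, Jensen), hyperuniformity of point processes
(TorquatoStillinger2003), linear response. Versus the 22 open routes:
the torus Palm-affinity routes (BECRieszShadow, BECLiebAntibunching) need the POINTWISE Palm entropy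
sup_(x,y) KL(P_x‖P_y) and a boundary
transfer; this line needs only the ANNEALED swap entropy, works in the Dirichlet box directly, and
every frame piece except uniqueness is now
in tree (SwapPurity.lean, GroundState.lean). Versus gen-1: items are typed over `groundState` (no
∀δ∃Ψ device), the refuted SwapJensen is repaired
(0 ≤ C), TraceSqLower is a Literature theorem, and `closes` reaches
`_root_.BoseEinsteinCondensation`.

RANKED CRUXES. #0 InsertionEntropyBound (target) — X_A. For every repulsive finite-range v there is
ρ₀ > 0 such that for 0 < ρ < ρ₀ there is C with: for all large N = n+1 the nonnegative Dirichlet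
ground state Ψ₀ = groundState v N (N/ρ)^(1/3) has accessible swap mass P_p(q ≠ 0) ≥ 1/2 and
accessible teleportation entropy ∫_(q≠0) p (log p − log q)⁺ ≤ C, where p(X,Y) = Ψ₀(X)²Ψ₀(Y)² and q =
p after x₀ ↔ y₀ (card: Δ_N = O(1); at the Jastrow/Bogoliubov level D ≈ const·√(ρa³)). KL-type,
strictly stronger than BEC; its mass half encodes existence of Ψ₀ (junk groundState = 0 gives mass
0). (why it might fail: KL currency is stronger than BEC: a marginal many-body infrared tail of log
Ψ₀ beyond density waves could make the teleportation entropy grow like log N while tr γ² stays ≥ cN²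
— as in d = 1, where Δ_N ≍ ½ log N (Lenard, Forrester et al.).) [PenroseOnsager1956, Reatto1969,
HerdmanEtAl2014, GirvinMacdonald1987, Lenard1964, ForresterEtAl2003]
#2 EntropyFromStructure (crux) — (card crux R + the variance bookkeeping, typed as ONE implication
about the same Ψ₀) for v, 0 < ρ < ρ₀(v) and ANY constants C_H, C_L there is C such that for all
large N = n+1: IF Ψ₀ is C_H-hyperuniform for 2π/L ≤ |k| ≤ √(ρa) (verbatim the body of
GroundStateHyperuniform) AND satisfies the one-body log-Harnack bounds with constant C_L at scale r
= (ρa)^(−1/2) (verbatim the body of OneBodyLogHarnack) AND its accessible swap mass is ≥ 1/2, THEN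
its accessible teleportation entropy is ≤ C. Intended proof: with U_X̂ = −log Ψ₀(·,X̂)² and f = log
p − log q = [U_X̂(y₀) − U_X̂(x₀)] + [U_Ŷ(x₀) − U_Ŷ(y₀)], bound E_p[f⁺; G] ≤ E|f_UV| + (E
f_IR²)^(1/2): UV part (scales ≤ r, local accessible averages of U) from the L-hypothesis; IR part
Σ_(|k|≤1/r)|Û_X̂(k)|² through the LINEAR-RESPONSE STRUCTURE Û_X̂(k) = ĥ(k)ρ̂_X̂(k) + r_X̂(k) with
|ĥ(k)| ≤ C/|k| (Reatto–Chester phonon symbol) and E|r|² summable, against the H-hypothesis: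
(C_H/ρ)∫_(|k|≤√(ρa)) k^(−2)·k/√(ρa) d³k = O(1), the k^(d−2) integrand; the change of measure n ↔
p_X̂ for the teleported point along p_t ∝ n e^(−tW) (card: Δ = ∫₀¹ E Var_(p_t)(W) dt). Trivially
true in the junk branch. [deps: GroundStateHyperuniform, OneBodyLogHarnack] [difficulty: XL] (why it
might fail: Needs density waves to be the ONLY infrared channel of log Ψ₀ (C/|k| response symbol,
summable remainder): triplet/backflow terms, marginal in 3+1 dimensions, could carry extra IR
weight, and the tilt n ↔ p_X̂ for the teleported point may cost what it is meant to bound.)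
[ReattoChester1967, Reatto1969, Chester1970, GirvinMacdonald1987, Feynman1954,
Literature.Barriers.AtomisticToContinuum.BogoliubovPerturbationInfraredNarrow]
#3 GroundStateHyperuniform (crux) — (card crux H; Dirichlet twin of TorusHyperuniformity
stmt-AtomisticToContinuum-9093, typed for Ψ₀) for v and 0 < ρ < ρ₀(v) there is C with: for all large
N = n+1 and every k = (2π/L)m, m ∈ ℤ³∖0 with |k| ≤ √(ρa) (a = scattering length; empty window for a
= 0): structureFactorVar N L Ψ₀ m = Var_(Ψ₀²)(Σ_j e^(ik·x_j)) ≤ C·N·|k|/√(ρa), i.e. S_N(k) ≤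
C|k|/√(ρa) uniformly down to the lowest mode (Bogoliubov: S = k/√(k² + 16πρa), C → 1/(4√π)). Route
to it: Onsager–Price / Pitaevskii–Stringari Schwarz inequality S(k) ≤ |k|√(χ_N(k)/N) for the ground
state (minimality beyond the value E₀) plus a static-response bound χ_N(k)/N ≤ C′/(ρa) from a
second-order (LHY-precision, inhomogeneous) energy LOWER bound for H_N + λΣ_i cos(k·x_i), λ in the
window (ρa³)^(1/4)ρa ≪ λ ≪ ρa. Trivially true in the junk branch. [difficulty: XL] (why it might
fail: Uniformity down to |k| = 2π/L in a DIRICHLET box rests on an LHY-precision lower bound for H_N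
+ λΣcos(k·x_i) that is not in print; the wall layer (thickness ξ, Poisson-like statistics) and the
canonical constraint could spoil the lowest modes or force C = C(ρ).) [PitaevskiiStringari1991,
Stringari1995, TorquatoStillinger2003, FournaisSolovej2020, Fournais2020, ReattoChester1967,
Literature.Barriers.AtomisticToContinuum.KineticGapLengthScalesNarrow]
#4 OneBodyLogHarnack (crux) — (card crux L) for v and 0 < ρ < ρ₀(v) there is C with: for all large N
= n+1, with r = (ρa)^(−1/2), B = ball(0,r) ⊂ ℝ³ and X^h = X with x₀ ↦ x₀ + h: (a) inaccessible
displaced mass ∫_B P_(X∼Ψ₀²)(Ψ₀(X^h) = 0) dh ≤ |B|/4 and (b) accessible log-oscillation ∫_B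
E_(X∼Ψ₀²)[|log Ψ₀²(X) − log Ψ₀²(X^h)|; Ψ₀(X^h) ≠ 0] dh ≤ C|B| — one-variable log-Harnack of the
ground state at the healing scale, Ψ₀²-typically and in first moment (not pointwise: (ρa³)^(−1/2)
neighbours sit within r, but only fluctuations of Σ_j u(x − x_j) enter, of variance O(√(ρa³)); cores
and walls give integrable log-singularities). Intended proofs: ground-state-transformed diffusion of
the tagged particle over time r² (the in-tree GroundStateFeynmanKac layer) plus coupling, or a Moser
log-Harnack inequality for the one-variable conditional amplitude with the frozen environment as
potential. Trivially true in the junk branch. [difficulty: L] (why it might fail: The first moment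
must be O(1) uniformly in N although (ρa³)^(−1/2) neighbours lie within r; near-core (hard or steep
soft) and near-wall log-singularities must stay integrable with N-uniform constants; the
tagged-particle coupling argument is heuristic.) [ReedSimonIV1978, ChungZhao1995, Reatto1969,
ReattoChester1967, McMillan1965, LiebSeiringerSolovejYngvason2005]
#5 GroundStateCondensate (crux) — (frame crux: identification of condensateNumber with THE ground
state, documented but deliberately not asserted in GroundState.lean) for v, 0 < ρ < ρ₀(v) and all
large N = n+1: maxOccupation N Ψ₀ ≤ condensateNumber v N L, i.e. λ_max of the nonnegative ground
state bounds from below the sup_δ inf of λ_max over δ-near-minimisers. Content: Rellich compactness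
of energy-bounded trial states on Λ_L^N, `IsGroundState.of_tendstoL2`, UNIQUENESS up to phase
(HasUniqueGroundState: Perron–Frobenius, in tree for bounded v as GroundStateFeynmanKac_holds; hard
cores: energetic dominance of the dilute component of the accessible region) and
L²-lower-semicontinuity of maxOccupation (sup of L²-continuous occupations). Trivially true in the
junk branch (maxOccupation 0 = 0). [difficulty: L] (why it might fail: Needs a UNIQUE ground state
at fixed large N: automatic for finite v (positivity improving) but for hard cores / ⊤-shells the
accessible region disconnects (Reed–Simon XIII.48(b); sparse jammed packings, Kahle2012) and a tie
between components would put condensateNumber below λ_max(Ψ₀).) [ReedSimonIV1978, Kato1966,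
Kahle2012, BaryshnikovBubenikKahle2013, GlimmJaffe1987, LiebSeiringerSolovejYngvason2005]
#9 TruncatedSwapJensen (support) — (identity + truncated Jensen; REPAIRED form of the refuted
BECSwapAffinity.SwapJensen = stmt-AtomisticToContinuum-3980: the hypothesis 0 ≤ C is added — the n =
0, θ = 1, C = −2 witness of BECSwapAffinitySwapJensen_refuted is excluded and for C ≥ 0 the argument
is untouched; typed for any measurable Φ ≥ 0 with ∫Φ² ≤ 1, so it applies to groundState in both
branches) for every n, Φ, θ > 0 and C ≥ 0: accessible mass ≥ θ and accessible swap entropy ≤ C imply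
swapPurity n Φ ≥ θ·exp(−C/(2θ)). Proof: swapPurity = ∫√(pq) (`swapPurity_eq_lintegral_of_nonneg`) =
P(G)·E_(P(·|G))√(q/p) ≥ P(G)·exp(−D/(2P(G))) by Jensen for exp on the probability P(·|G) ((log q/p)⁺
is integrable since E√(q/p) ≤ P(G)^(−1/2), (log q/p)⁻ by hypothesis), D ≤ C, and M ↦ M e^(−C/(2M))
is increasing for C ≥ 0; Real.log 0 = 0 matches 0·log 0 = 0. [difficulty: M] [PenroseOnsager1956,
HerdmanEtAl2014, Reatto1969]
#9 GroundStateAccessible (support) — for v, 0 < ρ < ρ₀(v) and all large N = n+1 the accessible swap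
mass of Ψ₀ is ≥ 1/2. Content: EXISTENCE of the nonnegative ground state (minimising sequence of
trial states, H¹₀-boundedness, Rellich on Λ_L^N, lower semicontinuity of closedEnergy,
|Ψ|-symmetrisation; then groundState is not the junk 0 and ∫Ψ₀² = 1, `lintegral_groundState_sq`) and
CORE AVOIDANCE: for finite v, Ψ₀ > 0 a.e. on the box (positivity improving;
GroundStateFeynmanKac_holds for bounded v) so P(q ≠ 0) = ∫∫p = 1; for hard cores of diameter a the
teleported boson meets a core with probability ≤ 2·|B_a|·n^(−1)∫(ρ^(1)_Ψ₀)² ≤ C·ρa³ given an L² (or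
sup ≤ Cρ) bound on the one-body density of Ψ₀, uniformly in N. [difficulty: L] [ReedSimonIV1978,
ChungZhao1995, GlimmJaffe1987, LiebSeiringerSolovejYngvason2005]
#9 EntropyFrame (support) — (frame #1, so that `closes` is term-mode logic) InsertionEntropyBound →
TruncatedSwapJensen → GroundStateCondensate → BoseEinsteinCondensation. Proof (bookkeeping; every
analytic input in tree): fix v; ρ₀ = min of the two ρ₀'s; for ρ < ρ₀ take C from the target and C′ =
max C 0 (ENNReal.ofReal C = ofReal C′); eventually in n: TruncatedSwapJensen with θ = 1/2, Φ = Ψ₀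
(measurable_groundState, groundState_nonneg, ∫Ψ₀² ≤ 1 in both branches via lintegral_groundState_sq
/ groundState_of_not_exists) gives swapPurity n Ψ₀ ≥ ½e^(−C′);
`succ_mul_swapPurity_le_maxOccupation` gives maxOccupation (n+1) Ψ₀ ≥ (n+1)·½e^(−C′);
GroundStateCondensate gives ofReal(½e^(−C′)(n+1)) ≤ condensateNumber v (n+1) L; the index shift n+1
↦ N under atTop yields HasGroundStateBEC v ρ with c = ½e^(−C′) for every ρ < ρ₀, i.e.
`_root_.BoseEinsteinCondensation` (abbrev of the Literature conjecture). [difficulty: provable-now]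
[PenroseOnsager1956, LiebSeiringerSolovejYngvason2005]

TWO-LAYER PLAN. Foreseen glued splits (nothing filed now; k ≤ 3, depth 1). EntropyFromStructure ⇐
ResponseSymbolBound (|ĥ(k)| ≤ C/|k| for the accessible,
r-smoothed insertion field of Ψ₀ on 2π/L ≤ |k| ≤ 1/r) → RemainderSummable (E Σ_(|k|≤1/r)|r_X̂(k)|² ≤
C) → VarianceToEntropy (deterministic
bookkeeping D ≤ E|f_UV| + (E f_IR²)^(1/2) with the accessible truncation and the tilt n ↔ p_X̂) →
EntropyFromStructure.
GroundStateHyperuniform ⇐ SchwarzSumRule (S_N(k)² ≤ k²χ_N(k)/N for Ψ₀, double commutator +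
minimality) → StaticResponseBound (χ_N(k)/N ≤ C/(ρa)
on the window: second-order lower bound for H_N + λΣcos(k·x_i)) → GroundStateHyperuniform;
StaticResponseBound is the item the family shares
(kv-insertion K1, one-particle-at-a-time, diamagnetic C2, palm-kl-sum-rule K2 per audit-32) and has
the torus twin stmt-9093.
GroundStateCondensate ⇐ GroundStateUnique (∀ᶠ N, HasUniqueGroundState v N L: PF for finite v,
energetic dominance of the dilute component for
hard cores) → SublevelCompact (Rellich at fixed N + lsc of maxOccupation) → GroundStateCondensate.
GroundStateAccessible ⇐ GroundStateExists →
DensityBound → GroundStateAccessible. A torus variant of H/L/R plugs into BoundaryTransferWeak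
(stmt-0827) if the Dirichlet wall layer obstructs H.

KILL CRITERIA. A refutation of InsertionEntropyBound for some admissible v at arbitrarily small ρ
(teleportation entropy of Ψ₀ unbounded in N) closes the
route (`close --reason refuted:InsertionEntropyBound`); the conjunct survives (KL is strictly
stronger than BEC) and the census goes to the
affinity-only cards (swap-overlap-no-catastrophe). ¬GroundStateHyperuniform (S_N at the lowest
Dirichlet modes ≳ const) forces a pivot, not a
close: restate H as the AVERAGED bound Σ_(|k|≤√(ρa)) S_N(k)/|k|² that the bookkeeping consumes, or
move H/L/R to the torus behind stmt-0827.
¬OneBodyLogHarnack in first moment → restate at scale c·r or in quantile form.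
¬GroundStateCondensate can only come from ⊤-valued v
(degenerate ground states by caging): pivot to an explicit `HasUniqueGroundState` hypothesis-item
plus a hard-core transfer. ¬EntropyFromStructure
with H and L standing = density waves are not the only infrared channel of log Ψ₀: close the route
and hand the census to BECRenormGroup /
BECNewtonPolicyIteration (whose Ward identities / policy iteration are then the remaining handles on
log Ψ₀). A refutation of a SUPPORT item
(TruncatedSwapJensen, EntropyFrame, GroundStateAccessible) means a mis-typing, not a dead line:
repair by a new item as done here for SwapJensen.
PalmAffinityBound (stmt-9157) + BoundaryTransferWeak proved elsewhere, or X_B1 (stmt-0686), moots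
the frame but not cruxes R/H/L.

NOT DECOMPOSED YET. The internal structure of crux R (symbol bound / remainder / variance→entropy
bookkeeping), the two halves of crux H (Schwarz sum rule,
static-response energy bound), existence vs. density bound inside GroundStateAccessible, and
uniqueness vs. compactness inside
GroundStateCondensate are deliberately NOT filed: they are layer-2 children once a crux closes or a
prover proposes the split (see Two-layer
plan). Constants (C_H → 1/(4√π), D ≈ const·√(ρa³)), the torus variants, the degenerate case a = 0
(free gas: H and L vacuous, D = 0, P(G) = 1,
every item consistent), second-moment versions of L, and positive temperature stay inside proofs. No
definition is load-bearing
(swapPurity, structureFactorVar, groundState exist; p, q, G are inlined with `let`).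

CHEAPEST FALSIFIER. (1) Pair-product check (paper, one page): for Ψ_J = Π f(x_i − x_j) with f the
zero-energy scattering solution healed at ξ, D = E_n[U; acc] −
E_(p_X̂)[U] + O(1) with U = Σ_j u(x − x_j); cluster/HNC leading order −ρ∫(e^(−u) − 1)u − ρ∫u(g − 1)
= C√(ρa³) + O(ρR₀³‖u‖_∞), N-independent
(Reatto1969's μ_ex computation) — if it grows with N (log N as in d = 1) the line is dead already at
the Jastrow level. (2) a = 0 (v ≡ 0 a.e.):
Ψ₀ is a product, p = q, D = 0, P(G) = 1, the H/L windows are empty — every item consistent (checked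
by hand; the n = 0, C = −2 witness that
refuted gen-1's SwapJensen is excluded by 0 ≤ C). (3) Numerics a refuter can run: PIGS swap
estimator of tr γ²/N² and of D for hard spheres
at ρa³ = 10⁻³, N = 64…512 (HerdmanEtAl2014 estimator): D must be flat in N (≈ const·√(ρa³) ≈
0.05–0.15). (4) Lowest-mode structure factor of
a Dirichlet-box Bogoliubov ground state (explicit quadratic form): Var(ρ̂_(2π/L)) must be
O(N/(L√(ρa))) — a wall layer of thickness ξ adds at
most the same order ρξL²; an O(N) answer kills H's "down to 2π/L". Not run here (compute-free seat).

NUMBERS. Bogoliubov (ħ = 2m = 1): ε(k) = √(k⁴ + 16πρa k²), S(k) = k²/ε(k) = k/√(k² + 16πρa) ≤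
k/(4√(πρa)) for all k, so C_H = 1/(4√π) ≈ 0.141 works
uniformly; healing length ξ = (8πρa)^(−1/2), r = (ρa)^(−1/2) = √(8π)ξ ≈ 5.0ξ; neighbours within r:
(4π/3)ρr³ = (4π/3)(ρa³)^(−1/2);
insertion-field variance at the Bogoliubov level ρ∫|û|²S d³k/(2π)³ with û = (1/S − 1)/ρ ≈
4√(πa/ρ)/k: ≈ (8/√π)√(ρa³) (IR, integrand ∝ k) plus
O(√(ρa³)) (UV, 2a/r tail) — bounded, N-independent; depletion 1 − n₀/N = (8/(3√π))√(ρa³) ≈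
1.505√(ρa³); hard spheres at ρa³ = 10⁻³:
condensate fraction ≈ 0.95, inaccessible swap mass ≈ 2·(4π/3)ρa³·O(1) ≈ 0.01 ≪ 1/2; LHY: e₀ = 4πρa(1
+ (128/(15√π))√(ρa³)) (FournaisSolovej2020
lower bound). d = 1 contrast: Δ_N ≍ ½ log N, n₀ ≍ √N (Lenard1964, ForresterEtAl2003). Items at open:
9 (1 target, 4 cruxes, 3 supports, 1 assembly).

DEFINITION REQUESTS. Hygiene only (statements inline them with `let`; nothing load-bearing):
`BoseGas.swapMass n Φ` := ∫⁻_(q≠0) ofReal p and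
`BoseGas.swapEntropy n Φ` := ∫⁻_(q≠0) ofReal (p (log p − log q)) for real Φ on (ℝ³)^(n+1)
(accessible swap mass / teleportation entropy at
coordinate 0; companions of `BoseGas.swapPurity` in SwapPurity.lean), topic
Literature/MathematicalPhysics/QuantumManyBody, to be filed after
open `--for` the target. Already landed since gen-1 and USED here: `BoseGas.swapPurity` (+ the PO
inequality and the Bhattacharyya identity,
proved), `BoseGas.structureFactorVar`, `BoseGas.groundState` / `IsGroundState` /
`HasUniqueGroundState`.

Novelty: Searches (2026-08-15, this seat): `lit search --hybrid --no-graph "hyperuniformity structure factor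
ground state Bose gas small momentum bound"`
(8 textbook hits: LSSY2005 pp 55–56, Griffin1993, Di Castro–Raimondi — none with a theorem); `lit
search --source crossref "relative entropy
lower bound condensate fraction one-body density matrix positive ground state"` (9: Lam–Chang 1976
doi:10.1016/0375-9601(76)90407-2 and
Fernandez–Gersch 1973 doi:10.1103/physreva.7.239, variational n₀ of He-4, no inequality of this
type); `lit search --source crossref "hyperuniform
quantum ground state bosons helium structure factor linear small k"` (7, none relevant); `lit search
--source zbmath "structure factor dilute Bose
gas Bogoliubov rigorous"` (0); `lit frontier AtomisticToContinuum --since 2022` (30 rows; the two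
2026 condensation papers, arXiv:2510.20493
kinetic localization via Poincaré inequalities and arXiv:2603.20776 Neumann propagation of
condensation, are kinetic-gap class); `lit galaxy
search "condensate fraction from the excess chemical potential of a test particle" --star all` (0),
`"hyperuniform Bose ground state"` (0),
`"hyperuniformity"` / `"Bhattacharyya" --star pdf` (16 / 6, all off-topic); arXiv / S2 / OpenAlex
rate-limited (429 / budget exhausted) during
this session. Plus the card's FIVE refuter novelty audits (audit-1/14/16/29/32, all NEW-COMBINATION)
whose searches I rely on.
Nearest prior art found: HerdmanEtAl2014 (doi:10.1103/physrevb.89.140501) and HerdmanDelmaes  [refs: 10.1016/0375-9601(76, 10.1103/physreva.7.239, 10.1103/physrevb.89.140501, 10.1103/physrevb.91.184507, 10.1103/physrev.183.334, 2510.20493, 2603.20776, doi:10.1016/0375-9601, doi:10.1103/physreva.7.239, doi:10.1103/physrevb.89.140501, doi:10.1103/physrevb.91.184507, doi:10.1103/physrev.183.334, LSSY2005, Griffin1993, HerdmanEtAl2014, HerdmanDelmaestro2015, HastingsEtAl2010, Reatto1969, Chester1970,]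

Barriers (technique_class: positivity entropy-inequality hyperuniformity response): - technique_class: positivity entropy-inequality hyperuniformity response
- Literature.Barriers.AtomisticToContinuum.KineticGapLengthScales: evaded — no step bounds depletion
by (box side)² × energy excess; the target is λ_max via tr γ² and positivity of Ψ₀, which the
narrowed block KineticGapLengthScalesNarrow (2026-08-15) lists as OUTSIDE the bound energy-window
class ("arguments using the minimality of the true ground state beyond the value E₀ … and
λ_max-targets"; "whether positivity Ψ₀ > 0 plus repulsion is an exit is open" — this route is that
bet); L enters only through |k| ≥ 2π/L in a convergent k-sum. Honest caveat: crux H's intended proof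
uses a second-order energy lower bound — for a RESPONSE coefficient at fixed k, not for depletion,
so no L² loss; if a prover routes H through box localisation with a gap the barrier re-enters there.
- Literature.Barriers.AtomisticToContinuum.EnergyAsymptoticsWithoutCondensation: evaded by design —
the input is the law of the positive ground state (log Ψ₀), not e₀(ρ) to two orders; the 1-D
Lieb–Liniger/Tonks witness is reproduced correctly (log-correlated insertion field ⇒ Δ_N ≍ ½ log N ⇒
no BEC) and the narrowed block exempts d = 3-specific infrared-summability inferences, which is
exactly the k^(d−2) test.
- Literature.Barriers.AtomisticToContinuum.BogoliubovPerturbationInfrared: only STATIC,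
gauge-invariant objects enter (S_N(k), the density-response symbol ĥ(k)) and the variance integral
converges with one power of k to spare i

Novelty grade: new-combination — Refuter grade (g44-6). Gen-2 re-open of BECSwapAffinity, typed over groundState. Mechanism stripped of vocabulary: Penrose–Onsager (5)–(6) (tr γ² ≤ Nλ_max, in tree and PROVED) + Bhattacharyya form of tr γ²/N² (in tree, PROVED) + Jensen on the one-particle exchange probability, so n₀/N ≥ P(G)·exp(−KL (refuter refuter-refute-pool-g44-6, 2026-08-15T19:09:40Z; prior: PenroseOnsager1956 §4 (5)-(7), Reatto1969, GirvinMacdonald1987, HerdmanEtAl2014, ReattoChester1967)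

History (route lifecycle, newest last):
- 2026-08-23T03:18:44Z · DORMANT — reconciler: no traction for 5.9 d (last activity item-evidence-added at 2026-08-17T05:59:59Z); parked, not closed — `ledger route dormant route-AtomisticToConti (operator:999:2137393)

sub-problem: BoseEinsteinCondensation · status: dormant · opened planner-plancard-AtomisticToContinuum-BoseEin-554a7d6f-g2-0 2026-08-15T18:48:28Z · rev 3 · ledger route-AtomisticToContinuum-BECInsertionVariance
GENERATED by the gate from the ledger (D-0016/17). Provers cite these decls: `theorem foo : Summit.AtomisticToContinuum.BoseEinsteinCondensation.Theses.BECInsertionVariance.<Decl> := …` in Summits/AtomisticToContinuum/BoseEinsteinCondensation/Theorems/<Name>.lean.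
-/

namespace Summit.AtomisticToContinuum.BoseEinsteinCondensation.Theses.BECInsertionVariance

open scoped BigOperators Topology Manifold Classical MeasureTheory ProbabilityTheory Matrix InnerProductSpace ComplexConjugate ContinuousMap
open Filter Set Function TopologicalSpace MeasureTheory

attribute [summit_statement] _root_.BoseEinsteinCondensation

/-- item stmt-AtomisticToContinuum-12063 · target · rank 0 · open · by planner
why it might fail: KL currency is stronger than BEC: a marginal many-body infrared tail of log Ψ₀ beyond density waves could make the teleportation entropy grow like log N while tr γ² stays ≥ cN² — as in d = 1, where Δ_N ≍ ½ log N (Lenard, Forrester et al.).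
sources: PenroseOnsager1956, Reatto1969, HerdmanEtAl2014, GirvinMacdonald1987, Lenard1964, ForresterEtAl2003
[target] X_A. For every repulsive finite-range v there is ρ₀ > 0 such that for 0 < ρ < ρ₀ there is C
with: for all large N = n+1 the nonnegative Dirichlet ground state Ψ₀ = groundState v N (N/ρ)^(1/3)
has accessible swap mass P_p(q ≠ 0) ≥ 1/2 and accessible teleportation entropy ∫_(q≠0) p (log p −
log q)⁺ ≤ C, where p(X,Y) = Ψ₀(X)²Ψ₀(Y)² and q = p after x₀ ↔ y₀ (card: Δ_N = O(1); at the
Jastrow/Bogoliubov level D ≈ const·√(ρa³)). KL-type, strictly stronger than BEC; its mass half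
encodes existence of Ψ₀ (junk groundState = 0 gives mass 0). -/
@[route_item "route-AtomisticToContinuum-BECInsertionVariance"]
def InsertionEntropyBound : Prop :=
  ∀ v : ℝ → ENNReal, Literature.MathematicalPhysics.QuantumManyBody.BoseGas.IsRepulsiveFiniteRange v → ∃ ρ₀ : ℝ, 0 < ρ₀ ∧ ∀ ρ : ℝ, 0 < ρ → ρ < ρ₀ → ∃ C : ℝ, ∀ᶠ n : ℕ in Filter.atTop, let Ψ₀ : Literature.MathematicalPhysics.QuantumManyBody.BoseGas.Config (n + 1) → ℝ := Literature.MathematicalPhysics.QuantumManyBody.BoseGas.groundState v (n + 1) (Literature.MathematicalPhysics.QuantumManyBody.BoseGas.sideLength ρ (n + 1)); let p : Literature.MathematicalPhysics.QuantumManyBody.BoseGas.Config (n + 1) × Literature.MathematicalPhysics.QuantumManyBody.BoseGas.Config (n + 1) → ℝ := fun Z => Ψ₀ Z.1 ^ 2 * Ψ₀ Z.2 ^ 2; let q : Literature.MathematicalPhysics.QuantumManyBody.BoseGas.Config (n + 1) × Literature.MathematicalPhysics.QuantumManyBody.BoseGas.Config (n + 1) → ℝ := fun Z => Ψ₀ (Function.update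 Z.1 0 (Z.2 0)) ^ 2 * Ψ₀ (Function.update Z.2 0 (Z.1 0)) ^ 2; (1 / 2 : ENNReal) ≤ (∫⁻ Z in {Z | q Z ≠ 0}, ENNReal.ofReal (p Z)) ∧ (∫⁻ Z in {Z | q Z ≠ 0}, ENNReal.ofReal (p Z * (Real.log (p Z) - Real.log (q Z)))) ≤ ENNReal.ofReal C

/-- item stmt-AtomisticToContinuum-12064 · crux · rank 2 · open · by planner
why it might fail: Needs density waves to be the ONLY infrared channel of log Ψ₀ (C/|k| response symbol, summable remainder): triplet/backflow terms, marginal in 3+1 dimensions, could carry extra IR weight, and the tilt n ↔ p_X̂ for the teleported point may cost what it is meant to bound.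
sources: ReattoChester1967, Reatto1969, Chester1970, GirvinMacdonald1987, Feynman1954, Literature.Barriers.AtomisticToContinuum.BogoliubovPerturbationInfraredNarrow
[crux] (card crux R + the variance bookkeeping, typed as ONE implication about the same Ψ₀) for v, 0
< ρ < ρ₀(v) and ANY constants C_H, C_L there is C such that for all large N = n+1: IF Ψ₀ is
C_H-hyperuniform for 2π/L ≤ |k| ≤ √(ρa) (verbatim the body of GroundStateHyperuniform) AND satisfies
the one-body log-Harnack bounds with constant C_L at scale r = (ρa)^(−1/2) (verbatim the body of
OneBodyLogHarnack) AND its accessible swap mass is ≥ 1/2, THEN its accessible teleportation entropy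
is ≤ C. Intended proof: with U_X̂ = −log Ψ₀(·,X̂)² and f = log p − log q = [U_X̂(y₀) − U_X̂(x₀)] +
[U_Ŷ(x₀) − U_Ŷ(y₀)], bound E_p[f⁺; G] ≤ E|f_UV| + (E f_IR²)^(1/2): UV part (scales ≤ r, local
accessible averages of U) from the L-hypothesis; IR part Σ_(|k|≤1/r)|Û_X̂(k)|² through the
LINEAR-RESPONSE STRUCTURE Û_X̂(k) = ĥ(k)ρ̂_X̂(k) + r_X̂(k) with |ĥ(k)| ≤ C/|k| (Reatto–Chester
phonon symbol) and E|r|² summable, against the H-hypothesis: (C_H/ρ)∫_(|k|≤√(ρa)) k^(−2)·k/√(ρa) d³k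
= O(1), the k^(d−2) integrand; the change of measure n ↔ p_X̂ for the teleported point along p_t ∝ n
e^(−tW) (card: Δ = ∫₀¹ E Var_(p_t)(W) dt). Trivially true in the junk branch. [deps:
GroundStateHyperuniform, OneBodyLogHarnack] -/
@[route_item "route-AtomisticToContinuum-BECInsertionVariance", crux]
def EntropyFromStructure : Prop :=
  ∀ v : ℝ → ENNReal, Literature.MathematicalPhysics.QuantumManyBody.BoseGas.IsRepulsiveFiniteRange v → ∃ ρ₀ : ℝ, 0 < ρ₀ ∧ ∀ ρ : ℝ, 0 < ρ → ρ < ρ₀ → ∀ C_H C_L : ℝ, ∃ C : ℝ, ∀ᶠ n : ℕ in Filter.atTop, (∀ m : Fin 3 → ℤ, m ≠ 0 → let L : ℝ := Literature.MathematicalPhysics.QuantumManyBody.BoseGas.sideLength ρ (n + 1); let a : ℝ := (Literature.MathematicalPhysics.QuantumManyBody.BoseGas.scatteringLength v).toReal; let k : ℝ := 2 * Real.pi / L * ‖(WithLp.toLp 2 fun t => (m t : ℝ) : EuclideanSpace ℝ (Fin 3))‖; k ≤ Real.sqrt (ρ * a) → Literature.MathematicalPhysics.QuantumManyBody.BoseGas.structureFactorVar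 (n + 1) L (fun X => (Literature.MathematicalPhysics.QuantumManyBody.BoseGas.groundState v (n + 1) L X : ℂ)) m ≤ ENNReal.ofReal (C_H * (n + 1) * k / Real.sqrt (ρ * a))) → (let L : ℝ := Literature.MathematicalPhysics.QuantumManyBody.BoseGas.sideLength ρ (n + 1); let Ψ₀ : Literature.MathematicalPhysics.QuantumManyBody.BoseGas.Config (n + 1) → ℝ := Literature.MathematicalPhysics.QuantumManyBody.BoseGas.groundState v (n + 1) L; let r : ℝ := (Real.sqrt (ρ * (Literature.MathematicalPhysics.QuantumManyBody.BoseGas.scatteringLength v).toReal))⁻¹; let B : Set Literature.MathematicalPhysics.QuantumManyBody.BoseGas.Space := Metric.ball 0 r; let Φ : Literature.MathematicalPhysics.QuantumManyBody.BoseGas.Config (n + 1) × Literature.MathematicalPhysics.QuantumManyBody.BoseGas.Space → ℝ := fun W => Ψ₀ (Function.update W.1 0 (W.1 0 + W.2)); (∫⁻ W in {W | W.2 ∈ B ∧ Φ W = 0}, ENNReal.ofReal (Ψ₀ W.1 ^ 2)) ≤ 4⁻¹ * MeasureTheory.volume B ∧ (∫⁻ W in {W | W.2 ∈ B ∧ Φ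 W ≠ 0}, ENNReal.ofReal (|Real.log (Ψ₀ W.1 ^ 2) - Real.log (Φ W ^ 2)| * Ψ₀ W.1 ^ 2)) ≤ ENNReal.ofReal C_L * MeasureTheory.volume B) → (let Ψ₀ : Literature.MathematicalPhysics.QuantumManyBody.BoseGas.Config (n + 1) → ℝ := Literature.MathematicalPhysics.QuantumManyBody.BoseGas.groundState v (n + 1) (Literature.MathematicalPhysics.QuantumManyBody.BoseGas.sideLength ρ (n + 1)); let p : Literature.MathematicalPhysics.QuantumManyBody.BoseGas.Config (n + 1) × Literature.MathematicalPhysics.QuantumManyBody.BoseGas.Config (n + 1) → ℝ := fun Z => Ψ₀ Z.1 ^ 2 * Ψ₀ Z.2 ^ 2; let q : Literature.MathematicalPhysics.QuantumManyBody.BoseGas.Config (n + 1) × Literature.MathematicalPhysics.QuantumManyBody.BoseGas.Config (n + 1) → ℝ := fun Z => Ψ₀ (Function.update Z.1 0 (Z.2 0)) ^ 2 * Ψ₀ (Function.update Z.2 0 (Z.1 0)) ^ 2; (1 / 2 : ENNReal) ≤ (∫⁻ Z in {Z | q Z ≠ 0}, ENNReal.ofReal (p Z)) → (∫⁻ Z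 in {Z | q Z ≠ 0}, ENNReal.ofReal (p Z * (Real.log (p Z) - Real.log (q Z)))) ≤ ENNReal.ofReal C)

/-- item stmt-AtomisticToContinuum-12065 · crux · rank 3 · open · by planner
why it might fail: Uniformity down to |k| = 2π/L in a DIRICHLET box rests on an LHY-precision lower bound for H_N + λΣcos(k·x_i) that is not in print; the wall layer (thickness ξ, Poisson-like statistics) and the canonical constraint could spoil the lowest modes or force C = C(ρ).
sources: PitaevskiiStringari1991, Stringari1995, TorquatoStillinger2003, FournaisSolovej2020, Fournais2020, ReattoChester1967
[crux] (card crux H; Dirichlet twin of TorusHyperuniformity stmt-AtomisticToContinuum-9093, typed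
for Ψ₀) for v and 0 < ρ < ρ₀(v) there is C with: for all large N = n+1 and every k = (2π/L)m, m ∈
ℤ³∖0 with |k| ≤ √(ρa) (a = scattering length; empty window for a = 0): structureFactorVar N L Ψ₀ m =
Var_(Ψ₀²)(Σ_j e^(ik·x_j)) ≤ C·N·|k|/√(ρa), i.e. S_N(k) ≤ C|k|/√(ρa) uniformly down to the lowest
mode (Bogoliubov: S = k/√(k² + 16πρa), C → 1/(4√π)). Route to it: Onsager–Price /
Pitaevskii–Stringari Schwarz inequality S(k) ≤ |k|√(χ_N(k)/N) for the ground state (minimality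
beyond the value E₀) plus a static-response bound χ_N(k)/N ≤ C′/(ρa) from a second-order
(LHY-precision, inhomogeneous) energy LOWER bound for H_N + λΣ_i cos(k·x_i), λ in the window
(ρa³)^(1/4)ρa ≪ λ ≪ ρa. Trivially true in the junk branch. [difficulty: XL] -/
@[route_item "route-AtomisticToContinuum-BECInsertionVariance", crux]
def GroundStateHyperuniform : Prop :=
  ∀ v : ℝ → ENNReal, Literature.MathematicalPhysics.QuantumManyBody.BoseGas.IsRepulsiveFiniteRange v → ∃ ρ₀ : ℝ, 0 < ρ₀ ∧ ∀ ρ : ℝ, 0 < ρ → ρ < ρ₀ → ∃ C : ℝ, ∀ᶠ n : ℕ in Filter.atTop, ∀ m : Fin 3 → ℤ, m ≠ 0 → let L : ℝ := Literature.MathematicalPhysics.QuantumManyBody.BoseGas.sideLength ρ (n + 1); let a : ℝ := (Literature.MathematicalPhysics.QuantumManyBody.BoseGas.scatteringLength v).toReal; let k : ℝ := 2 * Real.pi / L * ‖(WithLp.toLp 2 fun t => (m t : ℝ) : EuclideanSpace ℝ (Fin 3))‖; k ≤ Real.sqrt (ρ * a) → Literature.MathematicalPhysics.QuantumManyBody.BoseGas.structureFactorVar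 (n + 1) L (fun X => (Literature.MathematicalPhysics.QuantumManyBody.BoseGas.groundState v (n + 1) L X : ℂ)) m ≤ ENNReal.ofReal (C * (n + 1) * k / Real.sqrt (ρ * a))

/-- item stmt-AtomisticToContinuum-12066 · crux · rank 4 · open · by planner
why it might fail: The first moment must be O(1) uniformly in N although (ρa³)^(−1/2) neighbours lie within r; near-core (hard or steep soft) and near-wall log-singularities must stay integrable with N-uniform constants; the tagged-particle coupling argument is heuristic.
sources: ReedSimonIV1978, ChungZhao1995, Reatto1969, ReattoChester1967, McMillan1965, LiebSeiringerSolovejYngvason2005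
[crux] (card crux L) for v and 0 < ρ < ρ₀(v) there is C with: for all large N = n+1, with r =
(ρa)^(−1/2), B = ball(0,r) ⊂ ℝ³ and X^h = X with x₀ ↦ x₀ + h: (a) inaccessible displaced mass ∫_B
P_(X∼Ψ₀²)(Ψ₀(X^h) = 0) dh ≤ |B|/4 and (b) accessible log-oscillation ∫_B E_(X∼Ψ₀²)[|log Ψ₀²(X) − log
Ψ₀²(X^h)|; Ψ₀(X^h) ≠ 0] dh ≤ C|B| — one-variable log-Harnack of the ground state at the healing
scale, Ψ₀²-typically and in first moment (not pointwise: (ρa³)^(−1/2) neighbours sit within r, but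
only fluctuations of Σ_j u(x − x_j) enter, of variance O(√(ρa³)); cores and walls give integrable
log-singularities). Intended proofs: ground-state-transformed diffusion of the tagged particle over
time r² (the in-tree GroundStateFeynmanKac layer) plus coupling, or a Moser log-Harnack inequality
for the one-variable conditional amplitude with the frozen environment as potential. Trivially true
in the junk branch. [difficulty: L] -/
@[route_item "route-AtomisticToContinuum-BECInsertionVariance", crux]
def OneBodyLogHarnack : Prop :=
  ∀ v : ℝ → ENNReal, Literature.MathematicalPhysics.QuantumManyBody.BoseGas.IsRepulsiveFiniteRange v → ∃ ρ₀ : ℝ, 0 < ρ₀ ∧ ∀ ρ : ℝ, 0 < ρ → ρ < ρ₀ → ∃ C : ℝ, ∀ᶠ n : ℕ in Filter.atTop, let L : ℝ := Literature.MathematicalPhysics.QuantumManyBody.BoseGas.sideLength ρ (n + 1); let Ψ₀ : Literature.MathematicalPhysics.QuantumManyBody.BoseGas.Config (n + 1) → ℝ := Literature.MathematicalPhysics.QuantumManyBody.BoseGas.groundState v (n + 1) L; let r : ℝ := (Real.sqrt (ρ * (Literature.MathematicalPhysics.QuantumManyBody.BoseGas.scatteringLength v).toReal))⁻¹; let B :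 Set Literature.MathematicalPhysics.QuantumManyBody.BoseGas.Space := Metric.ball 0 r; let Φ : Literature.MathematicalPhysics.QuantumManyBody.BoseGas.Config (n + 1) × Literature.MathematicalPhysics.QuantumManyBody.BoseGas.Space → ℝ := fun W => Ψ₀ (Function.update W.1 0 (W.1 0 + W.2)); (∫⁻ W in {W | W.2 ∈ B ∧ Φ W = 0}, ENNReal.ofReal (Ψ₀ W.1 ^ 2)) ≤ 4⁻¹ * MeasureTheory.volume B ∧ (∫⁻ W in {W | W.2 ∈ B ∧ Φ W ≠ 0}, ENNReal.ofReal (|Real.log (Ψ₀ W.1 ^ 2) - Real.log (Φ W ^ 2)| * Ψ₀ W.1 ^ 2)) ≤ ENNReal.ofReal C * MeasureTheory.volume B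

/-- item stmt-AtomisticToContinuum-12067 · crux · rank 5 · open · by planner
why it might fail: Needs a UNIQUE ground state at fixed large N: automatic for finite v (positivity improving) but for hard cores / ⊤-shells the accessible region disconnects (Reed–Simon XIII.48(b); sparse jammed packings, Kahle2012) and a tie between components would put condensateNumber below λ_max(Ψ₀).
sources: ReedSimonIV1978, Kato1966, Kahle2012, BaryshnikovBubenikKahle2013, GlimmJaffe1987, LiebSeiringerSolovejYngvason2005
[crux] (frame crux: identification of condensateNumber with THE ground state, documented but
deliberately not asserted in GroundState.lean) for v, 0 < ρ < ρ₀(v) and all large N = n+1: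
maxOccupation N Ψ₀ ≤ condensateNumber v N L, i.e. λ_max of the nonnegative ground state bounds from
below the sup_δ inf of λ_max over δ-near-minimisers. Content: Rellich compactness of energy-bounded
trial states on Λ_L^N, `IsGroundState.of_tendstoL2`, UNIQUENESS up to phase (HasUniqueGroundState:
Perron–Frobenius, in tree for bounded v as GroundStateFeynmanKac_holds; hard cores: energetic
dominance of the dilute component of the accessible region) and L²-lower-semicontinuity of
maxOccupation (sup of L²-continuous occupations). Trivially true in the junk branch (maxOccupation 0
= 0). [difficulty: L] -/
@[route_item "route-AtomisticToContinuum-BECInsertionVariance", crux]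
def GroundStateCondensate : Prop :=
  ∀ v : ℝ → ENNReal, Literature.MathematicalPhysics.QuantumManyBody.BoseGas.IsRepulsiveFiniteRange v → ∃ ρ₀ : ℝ, 0 < ρ₀ ∧ ∀ ρ : ℝ, 0 < ρ → ρ < ρ₀ → ∀ᶠ n : ℕ in Filter.atTop, Literature.MathematicalPhysics.QuantumManyBody.BoseGas.maxOccupation (n + 1) (fun X => (Literature.MathematicalPhysics.QuantumManyBody.BoseGas.groundState v (n + 1) (Literature.MathematicalPhysics.QuantumManyBody.BoseGas.sideLength ρ (n + 1)) X : ℂ)) ≤ Literature.MathematicalPhysics.QuantumManyBody.BoseGas.condensateNumber v (n + 1) (Literature.MathematicalPhysics.QuantumManyBody.BoseGas.sideLength ρ (n + 1))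

/-- item stmt-AtomisticToContinuum-12068 · support · rank 9 · closed · proved by Summit.AtomisticToContinuum.BoseEinsteinCondensation.Theorems.truncatedSwapJensen_proof @ 0d3644d1b193 (prover) · by planner
sources: PenroseOnsager1956, HerdmanEtAl2014, Reatto1969
[support] (identity + truncated Jensen; REPAIRED form of the refuted BECSwapAffinity.SwapJensen =
stmt-AtomisticToContinuum-3980: the hypothesis 0 ≤ C is added — the n = 0, θ = 1, C = −2 witness of
BECSwapAffinitySwapJensen_refuted is excluded and for C ≥ 0 the argument is untouched; typed for any
measurable Φ ≥ 0 with ∫Φ² ≤ 1, so it applies to groundState in both branches) for every n, Φ, θ > 0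
and C ≥ 0: accessible mass ≥ θ and accessible swap entropy ≤ C imply swapPurity n Φ ≥
θ·exp(−C/(2θ)). Proof: swapPurity = ∫√(pq) (`swapPurity_eq_lintegral_of_nonneg`) =
P(G)·E_(P(·|G))√(q/p) ≥ P(G)·exp(−D/(2P(G))) by Jensen for exp on the probability P(·|G) ((log q/p)⁺
is integrable since E√(q/p) ≤ P(G)^(−1/2), (log q/p)⁻ by hypothesis), D ≤ C, and M ↦ M e^(−C/(2M))
is increasing for C ≥ 0; Real.log 0 = 0 matches 0·log 0 = 0. [difficulty: M] -/
@[route_item "route-AtomisticToContinuum-BECInsertionVariance", crux]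
def TruncatedSwapJensen : Prop :=
  ∀ (n : ℕ) (Φ : Literature.MathematicalPhysics.QuantumManyBody.BoseGas.Config (n + 1) → ℝ), Measurable Φ → (∀ X, 0 ≤ Φ X) → (∫⁻ X, (‖(Φ X : ℂ)‖₊ : ENNReal) ^ 2) ≤ 1 → ∀ θ C : ℝ, 0 < θ → 0 ≤ C → let p : Literature.MathematicalPhysics.QuantumManyBody.BoseGas.Config (n + 1) × Literature.MathematicalPhysics.QuantumManyBody.BoseGas.Config (n + 1) → ℝ := fun Z => Φ Z.1 ^ 2 * Φ Z.2 ^ 2; let q : Literature.MathematicalPhysics.QuantumManyBody.BoseGas.Config (n + 1) × Literature.MathematicalPhysics.QuantumManyBody.BoseGas.Config (n + 1) → ℝ := fun Z => Φ (Function.update Z.1 0 (Z.2 0)) ^ 2 * Φ (Function.update Z.2 0 (Z.1 0)) ^ 2; ENNReal.ofReal θ ≤ (∫⁻ Z in {Z | q Z ≠ 0}, ENNReal.ofReal (p Z)) → (∫⁻ Z in {Z | q Z ≠ 0}, ENNReal.ofReal (p Z * (Real.log (p Z) - Real.log (q Z)))) ≤ ENNReal.ofReal C → ENNReal.ofReal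 (θ * Real.exp (-(C / (2 * θ)))) ≤ Literature.MathematicalPhysics.QuantumManyBody.BoseGas.swapPurity n (fun X => (Φ X : ℂ))

/-- item stmt-AtomisticToContinuum-12069 · support · rank 9 · open · by planner
sources: ReedSimonIV1978, ChungZhao1995, GlimmJaffe1987, LiebSeiringerSolovejYngvason2005
[support] for v, 0 < ρ < ρ₀(v) and all large N = n+1 the accessible swap mass of Ψ₀ is ≥ 1/2.
Content: EXISTENCE of the nonnegative ground state (minimising sequence of trial states,
H¹₀-boundedness, Rellich on Λ_L^N, lower semicontinuity of closedEnergy, |Ψ|-symmetrisation; then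
groundState is not the junk 0 and ∫Ψ₀² = 1, `lintegral_groundState_sq`) and CORE AVOIDANCE: for
finite v, Ψ₀ > 0 a.e. on the box (positivity improving; GroundStateFeynmanKac_holds for bounded v)
so P(q ≠ 0) = ∫∫p = 1; for hard cores of diameter a the teleported boson meets a core with
probability ≤ 2·|B_a|·n^(−1)∫(ρ^(1)_Ψ₀)² ≤ C·ρa³ given an L² (or sup ≤ Cρ) bound on the one-body
density of Ψ₀, uniformly in N. [difficulty: L] -/
@[route_item "route-AtomisticToContinuum-BECInsertionVariance", crux]
def GroundStateAccessible : Prop :=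
  ∀ v : ℝ → ENNReal, Literature.MathematicalPhysics.QuantumManyBody.BoseGas.IsRepulsiveFiniteRange v → ∃ ρ₀ : ℝ, 0 < ρ₀ ∧ ∀ ρ : ℝ, 0 < ρ → ρ < ρ₀ → ∀ᶠ n : ℕ in Filter.atTop, let Ψ₀ : Literature.MathematicalPhysics.QuantumManyBody.BoseGas.Config (n + 1) → ℝ := Literature.MathematicalPhysics.QuantumManyBody.BoseGas.groundState v (n + 1) (Literature.MathematicalPhysics.QuantumManyBody.BoseGas.sideLength ρ (n + 1)); let p : Literature.MathematicalPhysics.QuantumManyBody.BoseGas.Config (n + 1) × Literature.MathematicalPhysics.QuantumManyBody.BoseGas.Config (n + 1) → ℝ := fun Z => Ψ₀ Z.1 ^ 2 * Ψ₀ Z.2 ^ 2; let q : Literature.MathematicalPhysics.QuantumManyBody.BoseGas.Config (n + 1) × Literature.MathematicalPhysics.QuantumManyBody.BoseGas.Config (n + 1) → ℝ := fun Z => Ψ₀ (Function.update Z.1 0 (Z.2 0)) ^ 2 * Ψ₀ (Function.update Z.2 0 (Z.1 0)) ^ 2; (1 / 2 : ENNReal) ≤ (∫⁻ Z in {Z |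 q Z ≠ 0}, ENNReal.ofReal (p Z))

/-- item stmt-AtomisticToContinuum-12070 · support · rank 9 · closed · proved by Summit.AtomisticToContinuum.BoseEinsteinCondensation.Theorems.entropyFrame_proof @ b4e002811808 (prover) · by planner
sources: PenroseOnsager1956, LiebSeiringerSolovejYngvason2005
[support] (frame #1, so that `closes` is term-mode logic) InsertionEntropyBound →
TruncatedSwapJensen → GroundStateCondensate → BoseEinsteinCondensation. Proof (bookkeeping; every
analytic input in tree): fix v; ρ₀ = min of the two ρ₀'s; for ρ < ρ₀ take C from the target and C′ =
max C 0 (ENNReal.ofReal C = ofReal C′); eventually in n: TruncatedSwapJensen with θ = 1/2, Φ = Ψ₀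
(measurable_groundState, groundState_nonneg, ∫Ψ₀² ≤ 1 in both branches via lintegral_groundState_sq
/ groundState_of_not_exists) gives swapPurity n Ψ₀ ≥ ½e^(−C′);
`succ_mul_swapPurity_le_maxOccupation` gives maxOccupation (n+1) Ψ₀ ≥ (n+1)·½e^(−C′);
GroundStateCondensate gives ofReal(½e^(−C′)(n+1)) ≤ condensateNumber v (n+1) L; the index shift n+1
↦ N under atTop yields HasGroundStateBEC v ρ with c = ½e^(−C′) for every ρ < ρ₀, i.e.
`_root_.BoseEinsteinCondensation` (abbrev of the Literature conjecture). [difficulty: provable-now] -/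
@[route_item "route-AtomisticToContinuum-BECInsertionVariance", crux]
def EntropyFrame : Prop :=
  InsertionEntropyBound → TruncatedSwapJensen → GroundStateCondensate → BoseEinsteinCondensation

/-- item stmt-AtomisticToContinuum-14107 · support · rank 9 · closed · proved by Summit.AtomisticToContinuum.BoseEinsteinCondensation.Theorems.becInsertionVariance_entropyTargetGlue_proof @ 86c75d189fc4 (prover) · by planner
[support] GLUE to the target (provable now, pure logic; route-repair for the badge stamp
`route.target-unreachable`): GroundStateHyperuniform → OneBodyLogHarnack → EntropyFromStructure →
GroundStateAccessible → InsertionEntropyBound. Proof (kernel-checked in the planner's Sketch.lean,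
rc 0, axioms propext/Classical.choice/Quot.sound): fix v; ρ₀ := min of the four ρ₀'s; for 0 < ρ < ρ₀
take C_H from H and C_L from L at ρ, then C from R at (C_H, C_L); `filter_upwards` the four eventual
sets in n — R's two hypotheses are verbatim the bodies of H and L, its mass hypothesis is verbatim
the body of GroundStateAccessible, and the target's conjunction is ⟨mass ≥ 1/2, entropy ≤ C⟩. With
it the deciding theorem is term-mode: closes := hF (hG hH hL hR hAcc) hJ hCnd. [deps:
GroundStateHyperuniform, OneBodyLogHarnack, EntropyFromStructure, GroundStateAccessible]
[difficulty: provable-now] [sources: PenroseOnsager1956, LiebSeiringerSolovejYngvason2005] -/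
@[route_item "route-AtomisticToContinuum-BECInsertionVariance", crux]
def EntropyTargetGlue : Prop :=
  GroundStateHyperuniform → OneBodyLogHarnack → EntropyFromStructure → GroundStateAccessible → InsertionEntropyBound

/-- item stmt-AtomisticToContinuum-12071 · assembly · rank 1 · closed · proved by Summit.AtomisticToContinuum.BoseEinsteinCondensation.Theorems.becInsertionVariance_assembly_proof @ 86c75d189fc4 (prover) · by planner
sources: PenroseOnsager1956, LiebSeiringerSolovejYngvason2005
[assembly] GroundStateHyperuniform → OneBodyLogHarnack → EntropyFromStructure →
GroundStateAccessible → TruncatedSwapJensen → GroundStateCondensate → EntropyFrame →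
BoseEinsteinCondensation. -/
@[route_item "route-AtomisticToContinuum-BECInsertionVariance"]
def Assembly : Prop :=
  GroundStateHyperuniform → OneBodyLogHarnack → EntropyFromStructure → GroundStateAccessible → TruncatedSwapJensen → GroundStateCondensate → EntropyFrame → BoseEinsteinCondensation

/-! D-0027 §2.1 — DECIDING THEOREM (planner-authored via `route open/edit --closes-file`; by planner-rbadge-AtomisticToContinuum-BECInserti-98492e3b-0 2026-08-16T03:25:45Z):
its hypotheses are this route's items and its conclusion the sub-problem Statement (glue_lint), and it elaborates with this file. -/

@[closes "route-AtomisticToContinuum-BECInsertionVariance"] theorem closes (hH : GroundStateHyperuniform) (hL : OneBodyLogHarnack) (hR : EntropyFromStructure)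
    (hAcc : GroundStateAccessible) (hG : EntropyTargetGlue) (hJ : TruncatedSwapJensen)
    (hCnd : GroundStateCondensate) (hF : EntropyFrame) : _root_.BoseEinsteinCondensation :=
  -- layer 1: cruxes H, L, R + accessibility ⊢ target (glue item EntropyTargetGlue);
  -- frame: target + truncated Jensen + condensate identification ⊢ Statement (EntropyFrame)
  hF (hG hH hL hR hAcc) hJ hCnd

end Summit.AtomisticToContinuum.BoseEinsteinCondensation.Theses.BECInsertionVariance
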